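import Mathlib.CategoryTheory.Generator.Sheaf
import Mathlib.Algebra.Homology.DerivedCategory.Ext.ExactSequences
import Mathlib.Algebra.Homology.ShortComplex.ShortExact
import Mathlib.CategoryTheory.Preadditive.Injective.Basic
import Mathlib.CategoryTheory.Retract
import Mathlib.CategoryTheory.Sites.EpiMono
import Mathlib.CategoryTheory.Limits.Constructions.EpiMono
import Literature.AlgebraicGeometry.Motives.EllAdicComparisonLimOneProofs
import Literature.AlgebraicGeometry.Motives.EtaleToProetLanProofs
import HarnessLib

/-!
# Bhatt–Scholze Cor. 5.1.6, local-to-global: the acyclicity of `ν*I` on `X_proét` follows from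
# its acyclicity on the affine objects of `X_ét`

`EtaleToProetExt.lean` reduces Bhatt–Scholze Cor. 5.1.6 (`nonempty_addEquiv_sheafH_etaleToProetPullback`:
`Hⁱ(X_ét, F) ≅ Hⁱ(X_proét, ν*F)`) — and with it the `lim¹` sequence of Prop. 5.6.2
(`ellAdicCohomology_limOneSequence`, `EllAdicComparisonLimOneProofs.lean`) — to the *global*
acyclicity hypothesis `hc`: `Hᵖ⁺¹(X_proét, ν*I) = 0` for every injective abelian étale sheaf `I`.
The printed proof of Cor. 5.1.6 (arXiv p. 29) proves a *local* statement — "it suffices to prove: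
`Hᵖ(U, ν*I) = 0` for `I ∈ Ab(X_ét)` injective, `p > 0`, and `U ∈ X_proét^aff`" — and passes to the
global one in one sentence: "The first part follows from the second part by checking it on sections
using Lemma 4.2.4, i.e., by applying `RΓ(V, –)` to the map `K → ν_*ν*K` for each affine
`V ∈ X_ét`." This file **proves that passage** on Mathlib's carriers, without Lemma 4.2.4:

* `subsingleton_ext_of_adjunction_of_local` — the homological skeleton, for any adjunction
  `L ⊣ R` between abelian categories (`T` with enough injectives, `L` preserving monomorphisms):
  if a class `P` of objects of `T` is stable under `N ↦ J/N` (`J` injective) and makes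
  `R J → R(J/N)` an epimorphism, then `Extⁿ⁺¹(L A, N) = 0` for every `N ∈ P` with `R N` injective
  (the degenerate case of the derived adjunction `RHom(L A, N) = RHom(A, R N)`: dimension shifting
  along `0 → N → J → Q → 0`, whose pushforward is short exact and split);
* `freeZSheaf J W = ℤ[h_W]` (Mathlib `Sheaf.freeYoneda`), `Hom(ℤ[h_W], F) = F(W)`
  (`freeZSheafHomEquiv`, natural in `F`), so that `Extᵖ(ℤ[h_W], F) = Hᵖ(W, F)` is the cohomology of
  the object `W`; `H¹(W, X₁) = 0` makes `X₂(W) → X₃(W)` surjective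
  (`surjective_app_of_subsingleton_ext_freeZSheaf`);
* `IsLocallyAcyclicOnAffineEtale X N`: `Hᵠ(ν V, N) = 0` for all affine `V ∈ X_ét`, `q ≥ 1` — the
  printed local statement restricted to the affine étale `U` (pro-étale affines with the trivial
  presentation, `isLocallyAcyclicOnAffineEtale_of_isProetAffine`); it is stable under `N ↦ J/N`
  and makes `ν_* J → ν_*(J/N)` locally surjective for the étale topology (lift over the affine opens
  of `V`, which cover it: `IsLocallyAcyclicOnAffineEtale.epi_pushforward_map` — this is "checking
  it on sections", the affine opens replacing Lemma 4.2.4);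
* `subsingleton_sheafH_etaleToProetPullbackULift_of_local` — **`hc` from the local statement**:
  for `N = ν*(ulift I)`, `ν_* N ≅ ulift I` (Lemma 5.1.2, `full_faithful_etaleToProetPullback_holds`)
  is injective as soon as `ulift : Shv(X_ét, Ab.{u}) → Shv(X_ét, Ab.{u+1})` preserves injectives
  (hypothesis `hL`, the coefficient-universe bookkeeping forced by `Scheme.EllAdicCohomology`), and
  `ν* ℤ_X = ℤ_X` (`pullbackConstantSheafIso`); hence
  `nonempty_addEquiv_sheafH_etaleToProetPullback_of_local` (**Cor. 5.1.6 from `hL` and the local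
  statement**) and `ellAdicCohomology_limOneSequence_of_local` (**Prop. 5.6.2 likewise**).

What remains of Cor. 5.1.6 after this file is exactly the printed affine claim
"`Hᵖ(U, ν*I) = 0` for `U ∈ X_proét^aff`, `p > 0`" (on the affine étale `U` only), whose printed proof
is the Čech computation over cofinal ind-étale covers (Thm. 2.3.4, [SGA4, V.4.3]), and `hL`.

## References

* B. Bhatt, P. Scholze, *The pro-étale topology for schemes*, Astérisque 369 (2015)
  (arXiv:1309.1198, held; arXiv p. 29): Cor. 5.1.6 and its proof ("The first part follows from
  the second part by checking it on sections … it suffices to prove: `Hᵖ(U, ν*I) = 0` for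
  `I ∈ Ab(X_ét)` injective, `p > 0`, and `U ∈ X_proét^aff`"), Lemma 5.1.2, Prop. 5.6.2.
  [BhattScholze2015]
* M. Artin, A. Grothendieck, J.-L. Verdier, *SGA 4*, Exposé V (cohomology `Hᵖ(U, F) = Extᵖ(ℤ_U, F)`
  of an object of a site, Leray for a morphism of sites); the degenerate derived adjunction used
  here is folklore.

## Design notes

* Only theorems and two abbreviations (`freeZSheaf`/`proetFreeZ` for Mathlib's `Sheaf.freeYoneda`
  with value `ℤ`, and the predicate `IsLocallyAcyclicOnAffineEtale`); no named facts (D-0026). The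
  two inputs `hL`, `hloc` of the final theorems are explicit hypotheses: `hloc` is the residual
  printed content of Cor. 5.1.6, `hL` a universe bookkeeping statement about étale sheaves.
* The homological part is proved for an abstract adjunction (`section Adjunction`) and an abstract
  site (`section FreeZ`) in their own universes; the pro-étale specialisation only supplies the
  affine-open covers of étale `X`-schemes (`ofArrows_etOfOpensι_mem`) and the epi criterion
  `Sheaf.isLocallySurjective_iff_epi'`.
* Mathlib searches: `Sheaf.freeYoneda`, `Sheaf.freeYonedaHomEquiv`, `Ext.covariant_sequence_exact₁/₃`,
  `ShortComplex.ShortExact.splittingOfInjective`, `Injective.injective_of_adjoint`,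
  `Retract.injective`, `Adjunction.unit_isIso_of_L_fully_faithful`, `isLimitForkMapOfIsLimit'`;
  Mathlib's `Sheaf.cohomologyPresheaf`/`Sheaf.H'` is tied to coefficients in the morphism universe
  of the site and is not usable on `X.ProEt` with `Ab.{u+1}`. Nothing restated.
-/

universe w' w v₁ v₂ u₁ u₂ u

open CategoryTheory Limits Opposite AlgebraicGeometry
open CategoryTheory.Abelian

noncomputable section

namespace Literature.AlgebraicGeometry.Motives

/-! ### Dimension shifting along a short exact sequence with injective middle term -/

section Shift

variable {D : Type u₁} [Category.{v₁} D] [Abelian D] [HasExt.{w'} D]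

/-- If `0 → X₁ → X₂ → X₃ → 0` is short exact with `X₂` injective and `Extⁿ⁺¹(A, X₃) = 0`, then
`Extⁿ⁺²(A, X₁) = 0` (long exact `Ext`-sequence in the second variable). [folklore] -/
theorem subsingleton_ext_X₁_of_shortExact {S : ShortComplex D} (hS : S.ShortExact)
    [Injective S.X₂] (A : D) (n : ℕ) [Subsingleton (Ext.{w'} A S.X₃ (n + 1))] :
    Subsingleton (Ext.{w'} A S.X₁ (n + 2)) := by
  refine ⟨fun x y => ?_⟩
  suffices h : ∀ z : Ext.{w'} A S.X₁ (n + 2), z = 0 by rw [h x, h y]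
  intro z
  obtain ⟨x₃, hx₃⟩ := Ext.covariant_sequence_exact₁ A hS z (Ext.eq_zero_of_injective _)
    (n₀ := n + 1) rfl
  rw [← hx₃, Subsingleton.elim x₃ 0, Ext.zero_comp]

/-- If `0 → X₁ → X₂ → X₃ → 0` is short exact with `X₂` injective and `Extⁿ⁺²(A, X₁) = 0`, then
`Extⁿ⁺¹(A, X₃) = 0`. [folklore] -/
theorem subsingleton_ext_X₃_of_shortExact {S : ShortComplex D} (hS : S.ShortExact)
    [Injective S.X₂] (A : D) (n : ℕ) [Subsingleton (Ext.{w'} A S.X₁ (n + 2))] :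
    Subsingleton (Ext.{w'} A S.X₃ (n + 1)) := by
  refine ⟨fun x y => ?_⟩
  suffices h : ∀ z : Ext.{w'} A S.X₃ (n + 1), z = 0 by rw [h x, h y]
  intro z
  obtain ⟨x₂, hx₂⟩ := Ext.covariant_sequence_exact₃ A hS z (n₁ := n + 2) rfl
    (Subsingleton.elim _ _)
  rw [← hx₂, Ext.eq_zero_of_injective x₂, Ext.zero_comp]

/-- If `0 → X₁ → X₂ → X₃ → 0` is short exact and `Ext¹(A, X₁) = 0`, then every morphism `A → X₃`
lifts to `X₂`. [folklore] -/
theorem exists_comp_eq_of_subsingleton_ext_one {S : ShortComplex D} (hS : S.ShortExact) (A : D)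
    [Subsingleton (Ext.{w'} A S.X₁ 1)] (φ : A ⟶ S.X₃) : ∃ ψ : A ⟶ S.X₂, ψ ≫ S.g = φ := by
  obtain ⟨x₂, hx₂⟩ := Ext.covariant_sequence_exact₃ A hS (Ext.mk₀ φ) (n₁ := 1) (zero_add 1)
    (Subsingleton.elim _ _)
  obtain ⟨ψ, rfl⟩ := (Ext.mk₀_bijective A S.X₂).2 x₂
  refine ⟨ψ, (Ext.mk₀_bijective A S.X₃).1 ?_⟩
  rw [← hx₂, Ext.mk₀_comp_mk₀]

end Shift

/-! ### The derived adjunction in its degenerate form: vanishing of `Ext(L A, N)` -/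

section Adjunction

variable {T : Type u₁} [Category.{v₁} T] [Abelian T] [HasExt.{w'} T]
  {S' : Type u₂} [Category.{v₂} S'] {L : S' ⥤ T} {R : T ⥤ S'}

/-- **Base case.** Let `L ⊣ R`, `0 → X₁ → X₂ → X₃ → 0` short exact in `T` with `X₂` injective, and
suppose `R X₂ → R X₃` has a section. Then `Ext¹(L A, X₁) = 0` for every `A`: a class in `Ext¹`
comes from a morphism `L A → X₃`, whose adjunct `A → R X₃` lifts to `R X₂` along the section, so
that the morphism lifts to `X₂` and the class dies. [folklore] -/
theorem subsingleton_ext_one_of_section (adj : L ⊣ R) {S : ShortComplex T} (hS : S.ShortExact)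
    [Injective S.X₂] (s : R.obj S.X₃ ⟶ R.obj S.X₂) (hs : s ≫ R.map S.g = 𝟙 _) (A : S') :
    Subsingleton (Ext.{w'} (L.obj A) S.X₁ 1) := by
  refine ⟨fun x y => ?_⟩
  suffices h : ∀ z : Ext.{w'} (L.obj A) S.X₁ 1, z = 0 by rw [h x, h y]
  intro z
  obtain ⟨x₃, hx₃⟩ := Ext.covariant_sequence_exact₁ (L.obj A) hS z
    (Ext.eq_zero_of_injective _) (zero_add 1)
  obtain ⟨φ, rfl⟩ := (Ext.mk₀_bijective (L.obj A) S.X₃).2 x₃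
  -- lift `φ` to `X₂` through the adjunction and the section `s`
  let ψ : L.obj A ⟶ S.X₂ := (adj.homEquiv _ _).symm (adj.homEquiv _ _ φ ≫ s)
  have hψ : ψ ≫ S.g = φ := by
    apply (adj.homEquiv _ _).injective
    rw [adj.homEquiv_naturality_right, Equiv.apply_symm_apply, Category.assoc, hs,
      Category.comp_id]
  rw [← hx₃, ← hψ, ← Ext.mk₀_comp_mk₀_assoc, hS.comp_extClass, Ext.comp_zero]

variable [Abelian S']

omit [HasExt.{w'} T] in
/-- The pushforward `0 → R X₁ → R X₂ → R X₃ → 0` of a short exact sequence along a right adjoint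
`R` is short exact as soon as `R X₂ → R X₃` is an epimorphism (a right adjoint is left exact);
if moreover `R X₁` is injective it splits. [folklore] -/
theorem exists_section_of_epi_map (adj : L ⊣ R) [R.PreservesZeroMorphisms] {S : ShortComplex T}
    (hS : S.ShortExact) [Epi (R.map S.g)] [Injective (R.obj S.X₁)] :
    ∃ s : R.obj S.X₃ ⟶ R.obj S.X₂, s ≫ R.map S.g = 𝟙 _ := by
  haveI : PreservesLimitsOfSize.{0, 0} R := adj.rightAdjoint_preservesLimits
  haveI := hS.mono_f
  haveI : Mono (S.map R).f := (Functor.preservesMonomorphisms_of_adjunction adj).preserves S.f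
  haveI : Epi (S.map R).g := ‹Epi (R.map S.g)›
  have hex : (S.map R).Exact :=
    ShortComplex.exact_of_f_is_kernel _ (isLimitForkMapOfIsLimit' R S.zero hS.exact.fIsKernel)
  have hS' : (S.map R).ShortExact := ShortComplex.ShortExact.mk' hex inferInstance inferInstance
  haveI : Injective (S.map R).X₁ := ‹Injective (R.obj S.X₁)›
  exact ⟨hS'.splittingOfInjective.s, hS'.splittingOfInjective.s_g⟩

/-- **Vanishing of `Ext(L A, N)` in positive degrees from a local acyclicity class.** Let `L ⊣ R`
be an adjunction between abelian categories (`T` with enough injectives, `L` preserving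
monomorphisms, so that `R` preserves injectives), and let `P` be a class of objects of `T` such
that for every short exact `0 → N → J → Q → 0` with `J` injective and `P N` one has `P Q` and
`R J → R Q` is an epimorphism. Then for every `N` with `P N` and `R N` injective,
`Extⁿ⁺¹(L A, N) = 0` for all `A` and `n` — by induction on `n` along `0 → N → J → Q → 0`:
`0 → R N → R J → R Q → 0` is short exact with `R N` injective, hence split, so `R Q` is a retract of
the injective `R J` and the base case applies. This is the degenerate form of the derived
adjunction `RHom(L A, N) = RHom(A, R N)` for `N` acyclic for `R` with `R N` injective.
[folklore] -/
theorem subsingleton_ext_of_adjunction_of_local (adj : L ⊣ R) [R.PreservesZeroMorphisms]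
    [L.PreservesMonomorphisms] [EnoughInjectives T] (P : T → Prop)
    (h₁ : ∀ ⦃S : ShortComplex T⦄, S.ShortExact → Injective S.X₂ → P S.X₁ → P S.X₃)
    (h₂ : ∀ ⦃S : ShortComplex T⦄, S.ShortExact → Injective S.X₂ → P S.X₁ → Epi (R.map S.g))
    (n : ℕ) (N : T) (hN : P N) (hRN : Injective (R.obj N)) (A : S') :
    Subsingleton (Ext.{w'} (L.obj A) N (n + 1)) := by
  induction n generalizing N with
  | zero =>
    obtain ⟨S, hS, hJ, rfl⟩ :
        ∃ S : ShortComplex T, S.ShortExact ∧ Injective S.X₂ ∧ S.X₁ = N :=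
      ⟨ShortComplex.mk _ _ (cokernel.condition (Injective.ι N)),
        { exact := ShortComplex.exact_cokernel _ }, inferInstance, rfl⟩
    haveI := hJ
    haveI := hRN
    haveI := h₂ hS hJ hN
    obtain ⟨s, hs⟩ := exists_section_of_epi_map adj hS
    exact subsingleton_ext_one_of_section adj hS s hs A
  | succ n ih =>
    obtain ⟨S, hS, hJ, rfl⟩ :
        ∃ S : ShortComplex T, S.ShortExact ∧ Injective S.X₂ ∧ S.X₁ = N :=
      ⟨ShortComplex.mk _ _ (cokernel.condition (Injective.ι N)),
        { exact := ShortComplex.exact_cokernel _ }, inferInstance, rfl⟩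
    haveI := hJ
    haveI := hRN
    haveI := h₂ hS hJ hN
    obtain ⟨s, hs⟩ := exists_section_of_epi_map adj hS
    haveI : Injective (R.obj S.X₂) := Injective.injective_of_adjoint adj _
    haveI : Injective (R.obj S.X₃) :=
      (Retract.mk s (R.map S.g) hs : Retract (R.obj S.X₃) (R.obj S.X₂)).injective
    haveI := ih S.X₃ (h₁ hS hJ hN) inferInstance
    exact subsingleton_ext_X₁_of_shortExact hS (L.obj A) n

end Adjunction

/-! ### The free abelian sheaf `ℤ[h_W]` and the cohomology `Hᵖ(W, –) = Extᵖ(ℤ[h_W], –)` of an object -/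

section FreeZ

variable {C : Type u₁} [Category.{v₁} C] (J : GrothendieckTopology C)
  [UnivLE.{v₁, w}] [HasWeakSheafify J AddCommGrpCat.{w}]

/-- **`ℤ[h_W]`**, the free abelian sheaf on the representable presheaf of `W` (coefficients in
`Ab.{w}`): the sheaf associated to `V ↦ ⊕_{V → W} ℤ` (Mathlib `Sheaf.freeYoneda`), so that
`Hom(ℤ[h_W], F) = F(W)` and `Extᵖ(ℤ[h_W], F) = Hᵖ(W, F)` is the cohomology of the object `W` with
coefficients in `F` (SGA 4 V; for `W` final this is `Sheaf.H`). [folklore] -/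
abbrev freeZSheaf (W : C) : Sheaf J AddCommGrpCat.{w} :=
  Sheaf.freeYoneda J W (AddCommGrpCat.of (ULift.{w} ℤ))

variable {J}

/-- `Hom(ℤ[h_W], F) ≃ F(W)` (Mathlib `Sheaf.freeYonedaHomEquiv` and `(ℤ ⟶ G) ≃ G`). [folklore] -/
def freeZSheafHomEquiv {W : C} {F : Sheaf J AddCommGrpCat.{w}} :
    (freeZSheaf J W ⟶ F) ≃ F.obj.obj (op W) :=
  Sheaf.freeYonedaHomEquiv.trans (AddCommGrpCat.uliftZMultiplesAddEquiv _).toEquiv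

/-- Naturality of `Hom(ℤ[h_W], F) ≃ F(W)` in `F`. [folklore] -/
theorem freeZSheafHomEquiv_comp {W : C} {F G : Sheaf J AddCommGrpCat.{w}} (φ : freeZSheaf J W ⟶ F)
    (f : F ⟶ G) : freeZSheafHomEquiv (φ ≫ f) = f.hom.app (op W) (freeZSheafHomEquiv φ) := by
  have h1 : (sheafificationAdjunction J AddCommGrpCat.{w}).homEquiv _ _ (φ ≫ f) =
      (sheafificationAdjunction J AddCommGrpCat.{w}).homEquiv _ _ φ ≫ f.hom :=
    Adjunction.homEquiv_naturality_right _ _ _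
  change AddCommGrpCat.uliftZMultiplesAddEquiv _ (Presheaf.freeYonedaHomEquiv (F := G.obj)
      ((sheafificationAdjunction J AddCommGrpCat.{w}).homEquiv _ _ (φ ≫ f))) =
    f.hom.app (op W) (AddCommGrpCat.uliftZMultiplesAddEquiv _
      (Presheaf.freeYonedaHomEquiv (F := F.obj)
        ((sheafificationAdjunction J AddCommGrpCat.{w}).homEquiv _ _ φ)))
  rw [h1, Presheaf.freeYonedaHomEquiv_comp]
  rfl

variable [HasSheafify J AddCommGrpCat.{w}] [HasExt.{w'} (Sheaf J AddCommGrpCat.{w})]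

/-- **`H¹(W, X₁) = 0` makes `X₂(W) → X₃(W)` surjective** for a short exact sequence of abelian
sheaves `0 → X₁ → X₂ → X₃ → 0` (`Hom(ℤ[h_W], –) = Γ(W, –)` and the long exact `Ext`-sequence).
[folklore] -/
theorem surjective_app_of_subsingleton_ext_freeZSheaf {S : ShortComplex (Sheaf J AddCommGrpCat.{w})}
    (hS : S.ShortExact) (W : C) [Subsingleton (Ext.{w'} (freeZSheaf J W) S.X₁ 1)] :
    Function.Surjective (S.g.hom.app (op W)) := by
  intro t
  obtain ⟨ψ, hψ⟩ := exists_comp_eq_of_subsingleton_ext_one hS (freeZSheaf J W)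
    (freeZSheafHomEquiv.symm t)
  refine ⟨freeZSheafHomEquiv ψ, ?_⟩
  rw [← freeZSheafHomEquiv_comp, hψ, Equiv.apply_symm_apply]

end FreeZ

/-! ### The local acyclicity class on `X_proét` and the pushforward criterion -/

section Local

variable (X : Scheme.{u})

/-- `ℤ[h_W]` on `X_proét` with coefficients in `Ab.{u+1}` (the coefficient convention of
`Scheme.EllAdicCohomology`), so that `Extᵖ(ℤ[h_W], N) = Hᵖ(W, N)` for `N ∈ Shv(X_proét, Ab)`.
[folklore] -/
abbrev proetFreeZ (W : X.ProEt) : Sheaf (Scheme.ProEt.topology X) AddCommGrpCat.{u + 1} :=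
  freeZSheaf.{u + 1} (Scheme.ProEt.topology X) W

/-- **Local acyclicity on the affine objects of `X_ét`**: the property of `N ∈ Shv(X_proét, Ab)`
that `Hᵠ(ν(V), N) = Ext^q(ℤ[h_{ν V}], N) = 0` for every *affine* `V ∈ X_ét` and every `q ≥ 1`
(for `N = ν*I` this is the printed "`Hᵖ(U, ν*I) = 0` for `U ∈ X_proét^aff`" of the proof of
Bhatt–Scholze Cor. 5.1.6, restricted to the affine étale `U`, which are pro-étale affines with the
trivial presentation). [cite: BhattScholze2015, Cor. 5.1.6 (proof)] -/
abbrev IsLocallyAcyclicOnAffineEtale :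
    ObjectProperty (Sheaf (Scheme.ProEt.topology X) AddCommGrpCat.{u + 1}) := fun N =>
  ∀ (V : X.Etale), IsAffine V.left → ∀ q : ℕ,
    Subsingleton (Ext.{u + 1} (proetFreeZ X ((etaleToProet X).obj V)) N (q + 1))

variable {X}

/-- The printed local statement on all of `X_proét^aff` ("`Hᵖ(U, ν*I) = 0` for `U ∈ X_proét^aff`",
read as the vanishing of `Extᵖ(ℤ[h_U], N)` for every `U` admitting a presentation, Def. 4.2.1)
implies the one on the affine étale objects, which are pro-étale affines with the trivial
presentation (`isProetAffine_etaleToProet_obj`). [cite: BhattScholze2015, Cor. 5.1.6 (proof)] -/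
theorem isLocallyAcyclicOnAffineEtale_of_isProetAffine
    {N : Sheaf (Scheme.ProEt.topology X) AddCommGrpCat.{u + 1}}
    (h : ∀ W : X.ProEt, isProetAffine X W → ∀ q : ℕ,
      Subsingleton (Ext.{u + 1} (proetFreeZ X W) N (q + 1))) :
    IsLocallyAcyclicOnAffineEtale X N := by
  intro V hV q
  haveI := hV
  exact h _ (isProetAffine_etaleToProet_obj X V) q

/-- The class is stable under passing to the cokernel of an embedding into an injective
(dimension shifting, objectwise). [folklore] -/
theorem IsLocallyAcyclicOnAffineEtale.X₃
    {S : ShortComplex (Sheaf (Scheme.ProEt.topology X) AddCommGrpCat.{u + 1})}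
    (hS : S.ShortExact) (hJ : Injective S.X₂) (h : IsLocallyAcyclicOnAffineEtale X S.X₁) :
    IsLocallyAcyclicOnAffineEtale X S.X₃ := by
  intro V hV q
  haveI := hJ
  haveI := h V hV (q + 1)
  exact subsingleton_ext_X₃_of_shortExact hS _ q

/-- **`ν_*` is exact on `0 → N → J → Q → 0` when `H¹(ν V, N) = 0` for all affine `V ∈ X_ét`**:
`ν_* J → ν_* Q` is locally surjective for the étale topology — a section of `Q` over `ν V` lifts to
`J` over `ν V'` for every affine open `V' ⊆ V`, and the affine opens cover `V`. This is "checking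
it on sections" in the proof of Bhatt–Scholze Cor. 5.1.6 (with Lemma 4.2.4 replaced by the affine
opens of `V`). [cite: BhattScholze2015, Cor. 5.1.6 (proof)] -/
theorem IsLocallyAcyclicOnAffineEtale.epi_pushforward_map
    {S : ShortComplex (Sheaf (Scheme.ProEt.topology X) AddCommGrpCat.{u + 1})}
    (hS : S.ShortExact) (h : IsLocallyAcyclicOnAffineEtale X S.X₁) :
    Epi ((proetToEtalePushforward X AddCommGrpCat.{u + 1}).map S.g) := by
  haveI : Sheaf.IsLocallySurjective ((proetToEtalePushforward X AddCommGrpCat.{u + 1}).map S.g) := by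
    constructor
    intro V s
    -- the affine opens of `V` (an étale `X`-scheme) cover it
    let 𝒰 := V.left.affineCover
    refine GrothendieckTopology.superset_covering _ ?_
      (ofArrows_etOfOpensι_mem V (fun i => (𝒰.f i).opensRange) fun x => ?_)
    · rw [Sieve.ofArrows, Sieve.generate_le_iff]
      rintro _ _ ⟨i⟩
      haveI : IsAffine (etOfOpens V (𝒰.f i).opensRange).left :=
        isAffineOpen_opensRange (𝒰.f i)
      haveI : Subsingleton (Ext.{u + 1}
          (proetFreeZ X ((etaleToProet X).obj (etOfOpens V (𝒰.f i).opensRange))) S.X₁ 1) :=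
        h (etOfOpens V (𝒰.f i).opensRange) inferInstance 0
      obtain ⟨t, ht⟩ := surjective_app_of_subsingleton_ext_freeZSheaf hS
        ((etaleToProet X).obj (etOfOpens V (𝒰.f i).opensRange))
        (S.X₃.obj.map ((etaleToProet X).map (etOfOpensι V (𝒰.f i).opensRange)).op s)
      exact ⟨t, ht⟩
    · obtain ⟨i, y, hy⟩ := 𝒰.exists_eq x
      exact ⟨i, ⟨y, hy⟩⟩
  exact (Sheaf.isLocallySurjective_iff_epi' AddCommGrpCat.{u + 1} _).1 this

/-- **`Extⁿ⁺¹(ν* A, N) = 0` for `N` locally acyclic on affine étale objects with `ν_* N`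
injective** (the derived adjunction for `ν* ⊣ ν_*` in its degenerate form,
`subsingleton_ext_of_adjunction_of_local`; `ν*` is exact, `Shv(X_proét, Ab)` is Grothendieck
abelian). [cite: BhattScholze2015, Cor. 5.1.6 (proof)] -/
theorem IsLocallyAcyclicOnAffineEtale.subsingleton_ext_etaleToProetPullback
    {N : Sheaf (Scheme.ProEt.topology X) AddCommGrpCat.{u + 1}}
    (hN : IsLocallyAcyclicOnAffineEtale X N)
    (hRN : Injective ((proetToEtalePushforward X AddCommGrpCat.{u + 1}).obj N))
    (A : Sheaf X.smallEtaleTopology AddCommGrpCat.{u + 1}) (n : ℕ) :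
    Subsingleton (Ext.{u + 1} ((etaleToProetPullback X).obj A) N (n + 1)) := by
  exact subsingleton_ext_of_adjunction_of_local (etaleToProetAdjunction X)
    (IsLocallyAcyclicOnAffineEtale X) (fun S hS hJ h => h.X₃ hS hJ)
    (fun S hS _ h => h.epi_pushforward_map hS) n N hN hRN A

end Local

/-! ### Bhatt–Scholze Cor. 5.1.6 and the `lim¹` sequence from the local statement -/

section Assembly

/-- **The acyclicity hypothesis `hc` of Cor. 5.1.6 from its local form.** If the change of
coefficient universe `ulift : Shv(X_ét, Ab.{u}) → Shv(X_ét, Ab.{u+1})` preserves injectives (`hL`)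
and `Hᵠ(ν V, ν*I) = 0` for every injective `I` of `Shv(X_ét, Ab.{u})`, every affine `V ∈ X_ét` and
every `q ≥ 1` (`hloc`, the printed "`Hᵖ(U, ν*I) = 0` for `U ∈ X_proét^aff`" on the affine étale
`U`), then `Hᵖ⁺¹(X_proét, ν*I) = 0` for every injective `I`: `ν_* ν* I = ulift I` (Lemma 5.1.2,
`full_faithful_etaleToProetPullback_holds`) is injective, so
`IsLocallyAcyclicOnAffineEtale.subsingleton_ext_etaleToProetPullback` applies with `A = ℤ_X`, and
`ν* ℤ_X = ℤ_X` (`pullbackConstantSheafIso`). [cite: BhattScholze2015, Cor. 5.1.6 (proof)] -/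
theorem subsingleton_sheafH_etaleToProetPullbackULift_of_local
    (hL : ∀ (X : Scheme.{u}) (I : Sheaf X.smallEtaleTopology AddCommGrpCat.{u}), Injective I →
      Injective ((uliftEtSheaf X).obj I))
    (hloc : ∀ (X : Scheme.{u}) (I : Sheaf X.smallEtaleTopology AddCommGrpCat.{u}), Injective I →
      IsLocallyAcyclicOnAffineEtale X ((etaleToProetPullbackULift X).obj I))
    (X : Scheme.{u}) (I : Sheaf X.smallEtaleTopology AddCommGrpCat.{u}) (hI : Injective I)
    (p : ℕ) : Subsingleton (((etaleToProetPullbackULift X).obj I).H (p + 1)) := by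
  haveI := (full_faithful_etaleToProetPullback_holds X).1
  haveI := (full_faithful_etaleToProetPullback_holds X).2
  -- `ν_* ν* (ulift I) ≅ ulift I` is injective
  have hRN : Injective ((proetToEtalePushforward X AddCommGrpCat.{u + 1}).obj
      ((etaleToProetPullbackULift X).obj I)) :=
    Injective.of_iso ((asIso (etaleToProetAdjunction X).unit).app ((uliftEtSheaf X).obj I))
      (hL X I hI)
  haveI : Subsingleton (Ext.{u + 1}
      ((constantSheaf X.smallEtaleTopology AddCommGrpCat.{u + 1} ⋙ etaleToProetPullback X).obj
        (AddCommGrpCat.of (ULift.{u + 1} ℤ))) ((etaleToProetPullbackULift X).obj I) (p + 1)) :=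
    (hloc X I hI).subsingleton_ext_etaleToProetPullback hRN
      ((constantSheaf X.smallEtaleTopology AddCommGrpCat.{u + 1}).obj
        (AddCommGrpCat.of (ULift.{u + 1} ℤ))) p
  exact (extAddEquivOfIsoLeft ((pullbackConstantSheafIso X).app
    (AddCommGrpCat.of (ULift.{u + 1} ℤ))) (p + 1)).toEquiv.subsingleton

/-- **Bhatt–Scholze Cor. 5.1.6 from its local statement** (and the preservation of injectives
under `ulift`). [cite: BhattScholze2015, Cor. 5.1.6] -/
theorem nonempty_addEquiv_sheafH_etaleToProetPullback_of_local
    (hL : ∀ (X : Scheme.{u}) (I : Sheaf X.smallEtaleTopology AddCommGrpCat.{u}), Injective I →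
      Injective ((uliftEtSheaf X).obj I))
    (hloc : ∀ (X : Scheme.{u}) (I : Sheaf X.smallEtaleTopology AddCommGrpCat.{u}), Injective I →
      IsLocallyAcyclicOnAffineEtale X ((etaleToProetPullbackULift X).obj I)) :
    nonempty_addEquiv_sheafH_etaleToProetPullback.{u} :=
  nonempty_addEquiv_sheafH_etaleToProetPullback_of_facts full_faithful_etaleToProetPullback_holds
    (subsingleton_sheafH_etaleToProetPullbackULift_of_local hL hloc)

/-- **The `lim¹` sequence `ellAdicCohomology_limOneSequence` (Bhatt–Scholze Prop. 5.6.2) from the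
local statement of Cor. 5.1.6** (and the preservation of injectives under `ulift`).
[cite: BhattScholze2015, Prop. 5.6.2 and Cor. 5.1.6] -/
theorem ellAdicCohomology_limOneSequence_of_local
    (hL : ∀ (X : Scheme.{u}) (I : Sheaf X.smallEtaleTopology AddCommGrpCat.{u}), Injective I →
      Injective ((uliftEtSheaf X).obj I))
    (hloc : ∀ (X : Scheme.{u}) (I : Sheaf X.smallEtaleTopology AddCommGrpCat.{u}), Injective I →
      IsLocallyAcyclicOnAffineEtale X ((etaleToProetPullbackULift X).obj I)) :
    ellAdicCohomology_limOneSequence.{u} :=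
  ellAdicCohomology_limOneSequence_of_acyclic
    (subsingleton_sheafH_etaleToProetPullbackULift_of_local hL hloc)

end Assembly

end Literature.AlgebraicGeometry.Motives

end
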